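import Mathlib
import HarnessLib
import Summits.NavierStokesRegularity.NavierStokesRegularity.Theorems.PoloidalWindowDoorLrcModEntireJetCertRelabelParts
import Summits.NavierStokesRegularity.NavierStokesRegularity.Theorems.PoloidalWindowDoorLrcModEntireTHCertSliceUD8TData

/-!
# Route `PoloidalWindowDoor`, item `LrcModEntire` (stmt-NavierStokesRegularity-20428) — unsteady slice dictionary with time jets `UD8T`:
# table-transfer checks, directions `x`, `y` (`…JetCertRelabelParts.relabelCheckDir`, `native_decide`)

Cell ns-regularity-ideate, seat ns-k2-port-2 g2 (`--supports stmt-NavierStokesRegularity-20428`; compute-cert lane).  Part of the relabeling certificate of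
`…THCertSliceUD8TData.sliceRelabel`, reassembled in `…THCertSliceUD8T`.  WHAT THIS IS NOT: not a claim about Navier–Stokes. [folklore]
-/

set_option maxRecDepth 100000

-- the summit and its single sub-problem share the name (CONVENTIONS §1), as in every Theorems file
set_option linter.dupNamespace false

namespace Summit.NavierStokesRegularity.NavierStokesRegularity.Theorems.PoloidalWindowDoorLrcModEntireTHCertSliceUD8TCheckB

open Summit.NavierStokesRegularity.NavierStokesRegularity.Theorems.PoloidalWindowDoorLrcModEntireJetCertDefs
open Summit.NavierStokesRegularity.NavierStokesRegularity.Theorems.PoloidalWindowDoorLrcModEntireJetCertMasked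
open Summit.NavierStokesRegularity.NavierStokesRegularity.Theorems.PoloidalWindowDoorLrcModEntireJetCertTree
open Summit.NavierStokesRegularity.NavierStokesRegularity.Theorems.PoloidalWindowDoorLrcModEntireJetCertFast2
open Summit.NavierStokesRegularity.NavierStokesRegularity.Theorems.PoloidalWindowDoorLrcModEntireJetCertCancel
open Summit.NavierStokesRegularity.NavierStokesRegularity.Theorems.PoloidalWindowDoorLrcModEntireJetCertRelabel
open Summit.NavierStokesRegularity.NavierStokesRegularity.Theorems.PoloidalWindowDoorLrcModEntireJetCertRelabelParts
open Summit.NavierStokesRegularity.NavierStokesRegularity.Theorems.PoloidalWindowDoorLrcModEntireTHCertLetters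
open Summit.NavierStokesRegularity.NavierStokesRegularity.Theorems.PoloidalWindowDoorLrcModEntireTHCert
open Summit.NavierStokesRegularity.NavierStokesRegularity.Theorems.PoloidalWindowDoorLrcModEntireTHCertSteady
open Summit.NavierStokesRegularity.NavierStokesRegularity.Theorems.PoloidalWindowDoorLrcModEntireTHCertExtra
open Summit.NavierStokesRegularity.NavierStokesRegularity.Theorems.PoloidalWindowDoorLrcModEntireTHCertSliceUD8TData

/-- Table transfer, direction `x` (`212` identities; one `native_decide`). [folklore] -/
theorem sliceRelabel_checkDir1 : relabelCheckDir sliceLetters.length (tableOf sliceLetters) (maskOf sliceLetters) (thHyps sliceLetters) sliceRelabel 1 = true := by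
  native_decide

/-- Table transfer, direction `y` (`212` identities; one `native_decide`). [folklore] -/
theorem sliceRelabel_checkDir2 : relabelCheckDir sliceLetters.length (tableOf sliceLetters) (maskOf sliceLetters) (thHyps sliceLetters) sliceRelabel 2 = true := by
  native_decide

end Summit.NavierStokesRegularity.NavierStokesRegularity.Theorems.PoloidalWindowDoorLrcModEntireTHCertSliceUD8TCheckB
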